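import Summits.BirchSwinnertonDyer.Rank1Residual.X5.SelmerSolitaireQuadraticPolar
import HarnessLib

/-!
# Selmer solitaire, QUADRATIC-SPACE LAYER (ii‴) — Q9: every totally singular subspace of `Q_D` has a CORE vertex

Cell `b2b-bsdres`, O1 programme (p = 2), ORDER v2.9 pool slot (ii‴) (o1 lead GEN 22, R-G22.6 (d) idle
menu: "the refuter by-product 'every TS Lagrangian has a core'"); pool hand x11b3-p4 GEN 5. Imports Q4a
(`X5.SelmerSolitaireQuadraticPolar`: the coordinates `ι` / new vertex on `Q_{D ∪ q}`, `q(ι x + (a,b)_q)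
= q(x) + ab`, `polar_single_fst`) and through it p2's `NF.polar_eq_zero_of_mem`. THEOREMS ONLY (no
definition, no named fact, no `sorry`).

HONEST FRAMING (cell, verbatim): research route; pure `𝔽₂` linear algebra — no curve, no Galois group,
no prime; nothing arithmetic asserted (in the dictionary this is the MODEL half of AR0 'core vertices
exist', which in lens-2's 2G10.1 is drawn from QS5 + the move supply AR4 — here it holds at FIXED `D`,
with no move, for every totally `q`-singular subspace regardless of dimension); reach-neutral (R1 closes
no class); nothing booked; no mark / label / count moved; O1 OPEN.

## What is proved
**`exists_coreQ`**: for every `s` and every totally `q`-singular subspace `U ≤ Q_D` (`∀ x ∈ U, q x = 0`;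
no dimension hypothesis) there is `n ⊆ D` with `CoreQ U n`, i.e. `U ∩ Λ*_n = 0` — a "coordinate
Lagrangian" `Λ*_n = ⊕_{ℓ ∈ n} ⟨t_ℓ⟩ ⊕ ⊕_{ℓ ∉ n} ⟨u_ℓ⟩` (zero at `∞`) transverse to `U`. Proof by induction
on `|D|`, peeling the last vertex `q`: write `y = ι(y|_old) + (a, b)_q` (Q4a `eq_iota_add_single`);
(I) if some `y₀ ∈ U` has `t_q`-coordinate `b = 1`, apply the induction hypothesis to the old parts of
`{x ∈ U : b(x) = 0}` (still totally singular: `q(x) = q(x|_old) + a·0`) to get `n'`, and take `n = n'`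
(`q ∉ n`): a vector of `U ∩ Λ*_n` has `b = 0`, old part in `Λ*_{n'}` hence `0`, so it is `a u_q`; and
`u_q ∉ U` because `⟨u_q, y₀⟩ = b(y₀) = 1` while `U` is totally isotropic (`NF.polar_eq_zero_of_mem`);
(II) otherwise `b ≡ 0` on `U`; apply the hypothesis to the old parts of `{x ∈ U : a(x) = 0}` and take
`n = n' ∪ {q}`: a vector of `U ∩ Λ*_n` has `a = 0`, old part `0`, and `b = 0` anyway. Helpers
under `CoreExists.*` (o1 lead GEN 23 R-G23.1 (b)); `CoreExists.coreQ_bot` (sanity). (Symplectic folklore: every isotropic subspace is transverse to some coordinate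
Lagrangian of a Darboux basis; here with the quadratic refinement and the marked vertex `∞`.)

## References
* lens-2 GEN 5 G5.1 Prop A / GEN 10 2G10.1 (AR0), 2G10.3 (`cells/o1/ROUTES-O1.md` l.1966–1988);
  B. Mazur, K. Rubin, Contemp. Math. 358 (2004), Def. 4.2 (core vertices) [MazurRubin2004Intro];
  B. Poonen, E. Rains, JAMS 25 (2012), §2 (maximal isotropic subspaces) [PoonenRains2012].
* Tree dedup (2026-08-21): `lean search 'exists_coreQ|exists_core.*Lagrangian|coreQ_bot'` → none.
-/

namespace Summit.BirchSwinnertonDyer.Rank1Residual.X5.SelmerSolitaire.Quadratic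

open Finset Matrix SelmerSolitaire

variable {s : ℕ}

namespace CoreExists

/-- Sanity: the zero subspace has every vertex core. [folklore] -/
theorem coreQ_bot (n : Finset (Fin s)) : CoreQ (⊥ : Submodule (ZMod 2) (QVec s)) n :=
  fun _ hx _ => (Submodule.mem_bot (R := ZMod 2)).mp hx

/-- `Λ*_{n'}` pulled back along `castSucc`: for `x` on `D ∪ {q}` with `x ∈ Λ*_{lift n'}` (resp.
`Λ*_{n' ∪ {q}}`) the old part `x|_old` lies in `Λ*_{n'}`, and the `t_q`- (resp. `u_q`-) coordinate of
`x` vanishes. [folklore] -/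
theorem inLamStar_old_of_inLamStar (n' : Finset (Fin s)) (x : QVec (s + 1)) :
    (InLamStar (lift n') x → InLamStar n' (fun v => x (oldV v)) ∧ (x (some (Fin.last s))).2 = 0) ∧
      (InLamStar (withNew n') x →
        InLamStar n' (fun v => x (oldV v)) ∧ (x (some (Fin.last s))).1 = 0) := by
  have hmem : ∀ i : Fin s, Fin.castSucc i ∈ lift n' ↔ i ∈ n' := fun i =>
    Finset.mem_map' Fin.castSuccEmb
  have hlast : Fin.last s ∉ lift n' := fun h => by
    obtain ⟨j, -, hj⟩ := Finset.mem_map.mp h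
    exact (Fin.castSucc_lt_last j).ne hj
  constructor
  · rintro ⟨h0, hlam⟩
    refine ⟨⟨h0, fun i => ⟨fun hi => (hlam (Fin.castSucc i)).1 ((hmem i).mpr hi),
      fun hi => (hlam (Fin.castSucc i)).2 fun h => hi ((hmem i).mp h)⟩⟩, (hlam (Fin.last s)).2 hlast⟩
  · rintro ⟨h0, hlam⟩
    refine ⟨⟨h0, fun i => ⟨fun hi => (hlam (Fin.castSucc i)).1 (Finset.mem_insert_of_mem ((hmem i).mpr hi)),
      fun hi => (hlam (Fin.castSucc i)).2 fun h => ?_⟩⟩,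
      (hlam (Fin.last s)).1 (Finset.mem_insert_self _ _)⟩
    rcases Finset.mem_insert.mp h with h | h
    · exact (Fin.castSucc_lt_last i).ne h
    · exact hi ((hmem i).mp h)

/-- A vector on `D ∪ {q}` whose old part vanishes is `(a, b)_q`. [folklore] -/
theorem eq_single_of_old_eq_zero {x : QVec (s + 1)} (h : (fun v => x (oldV v)) = 0) :
    x = Pi.single (some (Fin.last s)) (x (some (Fin.last s))) := by
  conv_lhs => rw [eq_iota_add_single x, h, iota_zero, zero_add]

end CoreExists

/-- **Every totally `q`-singular subspace of `Q_D` has a core vertex** (a coordinate Lagrangian `Λ*_n`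
transverse to it), by induction on `|D|` peeling the last vertex. [cite: MazurRubin2004Intro, Def. 4.2] -/
theorem exists_coreQ : ∀ (s : ℕ) (U : Submodule (ZMod 2) (QVec s)), (∀ x ∈ U, qform x = 0) →
    ∃ n : Finset (Fin s), CoreQ U n := by
  intro s
  induction s with
  | zero =>
    intro U _
    refine ⟨∅, fun x _ hx => funext fun v => ?_⟩
    cases v with
    | none => exact hx.1
    | some i => exact i.elim0
  | succ s ih =>
    intro U hU
    classical
    -- restriction to the old vertices and the two new coordinates, as linear maps
    let r : QVec (s + 1) →ₗ[ZMod 2] QVec s :=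
      { toFun := fun y v => y (oldV v), map_add' := fun _ _ => rfl, map_smul' := fun _ _ => rfl }
    let fu : QVec (s + 1) →ₗ[ZMod 2] ZMod 2 :=
      { toFun := fun y => (y (some (Fin.last s))).1, map_add' := fun _ _ => rfl,
        map_smul' := fun _ _ => rfl }
    let ft : QVec (s + 1) →ₗ[ZMod 2] ZMod 2 :=
      { toFun := fun y => (y (some (Fin.last s))).2, map_add' := fun _ _ => rfl,
        map_smul' := fun _ _ => rfl }
    -- `q(x) = q(x|_old)` whenever one of the two new coordinates of `x` vanishes
    have hq_old : ∀ x : QVec (s + 1),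
        (x (some (Fin.last s))).1 * (x (some (Fin.last s))).2 = 0 → qform (r x) = qform x := by
      intro x hx
      have h := qform_iota_add_single (r x) (x (some (Fin.last s)))
      rw [hx, add_zero] at h
      rw [← h]
      exact congrArg qform (eq_iota_add_single x).symm
    by_cases ht : ∃ y₀ ∈ U, (y₀ (some (Fin.last s))).2 = 1
    · -- (I) the `t_q`-coordinate does not vanish on `U`: `u_q ∉ U`, take `q ∉ n`
      obtain ⟨y₀, hy₀, hy₀t⟩ := ht
      obtain ⟨n', hn'⟩ := ih ((U ⊓ LinearMap.ker ft).map r) (by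
        rintro _ ⟨x, ⟨hxU, hxt⟩, rfl⟩
        have hxt' : (x (some (Fin.last s))).2 = 0 := LinearMap.mem_ker.mp hxt
        rw [hq_old x (by rw [hxt', mul_zero]), hU x hxU])
      refine ⟨lift n', fun x hxU hlam => ?_⟩
      obtain ⟨hold, hxt⟩ := (CoreExists.inLamStar_old_of_inLamStar n' x).1 hlam
      have hr0 : r x = 0 := hn' (r x) ⟨x, ⟨hxU, LinearMap.mem_ker.mpr hxt⟩, rfl⟩ hold
      have hx : x = (x (some (Fin.last s))).1 • uNew s := by
        rw [smul_uNew]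
        conv_lhs => rw [CoreExists.eq_single_of_old_eq_zero (show (fun v => x (oldV v)) = 0 from hr0)]
        congr 1
        exact Prod.ext rfl hxt
      rcases (by decide : ∀ c : ZMod 2, c = 0 ∨ c = 1) (x (some (Fin.last s))).1 with h1 | h1
      · rw [hx, h1, zero_smul]
      · exfalso
        rw [h1, one_smul] at hx
        have h := NF.polar_eq_zero_of_mem hU (hx ▸ hxU) hy₀
        rw [polar_comm, uNew_eq_single, polar_single_fst, hy₀t] at h
        exact one_ne_zero h
    · -- (II) the `t_q`-coordinate vanishes on `U`: take `q ∈ n`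
      have ht0 : ∀ y ∈ U, (y (some (Fin.last s))).2 = 0 := fun y hy => by
        rcases (by decide : ∀ c : ZMod 2, c = 0 ∨ c = 1) (y (some (Fin.last s))).2 with h | h
        · exact h
        · exact (ht ⟨y, hy, h⟩).elim
      obtain ⟨n', hn'⟩ := ih ((U ⊓ LinearMap.ker fu).map r) (by
        rintro _ ⟨x, ⟨hxU, hxu⟩, rfl⟩
        have hxu' : (x (some (Fin.last s))).1 = 0 := LinearMap.mem_ker.mp hxu
        rw [hq_old x (by rw [hxu', zero_mul]), hU x hxU])
      refine ⟨withNew n', fun x hxU hlam => ?_⟩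
      obtain ⟨hold, hxu⟩ := (CoreExists.inLamStar_old_of_inLamStar n' x).2 hlam
      have hr0 : r x = 0 := hn' (r x) ⟨x, ⟨hxU, LinearMap.mem_ker.mpr hxu⟩, rfl⟩ hold
      have hq0 : x (some (Fin.last s)) = 0 := Prod.ext hxu (ht0 x hxU)
      rw [CoreExists.eq_single_of_old_eq_zero (show (fun v => x (oldV v)) = 0 from hr0), hq0, Pi.single_zero]

/-- **Every totally singular Lagrangian has a core vertex** (the `IsTSLagrangian` form).
[cite: MazurRubin2004Intro, Def. 4.2] -/
theorem exists_coreQ_of_isTSLagrangian {U : Submodule (ZMod 2) (QVec s)} (hU : IsTSLagrangian U) :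
    ∃ n : Finset (Fin s), CoreQ U n :=
  exists_coreQ s U hU.1

end Summit.BirchSwinnertonDyer.Rank1Residual.X5.SelmerSolitaire.Quadratic
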